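import Mathlib
import HarnessLib
import Literature.Analysis.FluidPDE.VectorCalculus
import Literature.Analysis.FluidPDE.VectorCalculusProofs
import Literature.Analysis.FluidPDE.VorticityCalculus
import Literature.Analysis.FluidPDE.VorticityEquation
import Literature.Analysis.FluidPDE.AncientSimilarityVorticity
import Literature.Analysis.FluidPDE.AxisymmetricVorticityTransport
import Literature.Analysis.FluidPDE.EssCurry
import Literature.Analysis.FluidPDE.TypeIAncientMildClassical
import Literature.Analysis.PDE.HeatLiouville
import Summits.NavierStokesRegularity.NavierStokesRegularity.Theorems.LocalSineTubeDoorProfileAlignedWindowRigidityAncient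
import Summits.NavierStokesRegularity.NavierStokesRegularity.Theorems.PoloidalWindowDoorPoloidalWindowRigidityWindow
import Summits.NavierStokesRegularity.NavierStokesRegularity.Theorems.PoloidalWindowDoorPoloidalWindowRigidityDegenerate
import Summits.NavierStokesRegularity.NavierStokesRegularity.Theorems.PoloidalWindowDoorPoloidalWindowRigidityClassRate

/-!
# The one-window door family — the LAMB-VECTOR (Beltrami) door, profile side: BELTRAMI TYPE-I PROFILES ARE TRIVIAL

Cell ns-regularity-ideate, seat p6 (route-directed support for nsreg-p1's door family `LocalSineTubeDoor` (closed) /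
`PoloidalWindowDoor` / S10 / S11; anchor `--supports stmt-NavierStokesRegularity-20018`, the profile-rigidity item of the
family).  The PROFILE CRUX of a new door of the generic template (`…LocalSineTubeDoorGenericDoor`), with first-order
scalar the LAMB VECTOR `u × curl u` (whose vanishing is the Beltrami condition), is PROVED here:

**a profile of the family's Type-I class** (rate `‖v(t,x)‖ ≤ C/√(−t)`, continuity on the open slab, unit-viscosity
Oseen–Duhamel identity between negative times, divergence-free slices) **whose Lamb vector `v(s,·) × curl v(s,·)`
vanishes on every slice `s < 0` is identically zero** — in particular not backward-singular at the apex.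

Proof.  (1) `curl (v × ω) = (ω·∇)v − (v·∇)ω` for divergence-free `v`, `ω = curl v` (tree `curl_cross_apply` +
`div curl = 0`), so on a Beltrami slice the transport and stretching terms of the vorticity equation coincide
(`convect_curl_eq_of_beltrami`).  (2) The profile is a classical Navier–Stokes solution on every window `(t₀,0)`
(tree `IsTypeIAncientMild.exists_isClassicalNSSolutionOn_Ioo`), so its vorticity equation
`∂ₜω + (v·∇)ω = (ω·∇)v + Δω` (tree `IsClassicalNSSolutionOn.vorticity_eq`) collapses to the HEAT EQUATION `∂ₜω = Δω`
(`timeDeriv_curl_eq_laplacian_of_beltrami`).  (3) On every slab `(−∞,s₀) × ℝ³`, `s₀ < 0`, the vorticity is bounded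
by `C₂/(−s₀)` (the class's vorticity RATE `‖curl v(t)‖ ≤ C₂/(−t)`, tree `…ClassRate.exists_curl_rate_of_class`), so the
Liouville theorem for bounded ancient caloric functions (tree `Literature.Analysis.PDE.heat_liouville`, in the Carleman
frame via the dictionary `dt_uncurry` / `lap_uncurry`) makes it constant there; the constant is bounded by `C₂/(−t)` for
every `t < s₀`, hence zero (`curl_eq_zero_of_beltrami`).  (4) Irrotational profiles of the class vanish
(tree `…Degenerate.nonflatLiouville_of_irrotational` / `eq_zero_of_irrotational`).

* `convect_curl_eq_of_beltrami` — the pointwise identity (1);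
* `timeDeriv_curl_eq_laplacian_of_beltrami` — (2), the vorticity of a Beltrami profile is caloric;
* `curl_eq_zero_of_beltrami`, `eq_zero_of_beltrami`, `not_backwardSingular_of_beltrami` — (3)+(4);
* `analyticOnNhd_lamb_slice`, `lambWindowToSlab` — the Lamb vector of a slice is real-analytic, so vanishing on a
  nonempty open window of every slice spreads to the whole slice (identity theorem);
* `beltramiWindowRigidity` — the door's profile WINDOW crux in the generic template's `F`-form,
  `F(x, A) = ‖x × curlCLM A‖`: PROVED.

WHAT THIS IS NOT: not a claim about Navier–Stokes regularity (Clay A) — the profile-rigidity half of a local regularity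
CRITERION (conditional on local Type I) of the door family (bears_on LADDER-NS N0); establishment in the cell's sense
still requires the cross-family referee PASS + independent reproduction.
-/

noncomputable section

-- the summit and its single sub-problem share the name (CONVENTIONS §1), as in every Theorems file
set_option linter.dupNamespace false

namespace Summit.NavierStokesRegularity.NavierStokesRegularity.Theorems.LocalLambTubeDoorBeltramiProfileRigidity

open MeasureTheory Set Function Filter Topology TopologicalSpace Metric
open scoped RealInnerProductSpace InnerProductSpace Laplacian ContDiff
open Literature.Analysis Literature.Analysis.FluidPDE
open Summit.NavierStokesRegularity.NavierStokesRegularity.Theorems.LocalSineTubeDoorProfileAlignedWindowRigidityAncient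
open Summit.NavierStokesRegularity.NavierStokesRegularity.Theorems.PoloidalWindowDoorPoloidalWindowRigidityWindow
open Summit.NavierStokesRegularity.NavierStokesRegularity.Theorems.PoloidalWindowDoorPoloidalWindowRigidityDegenerate
open Summit.NavierStokesRegularity.NavierStokesRegularity.Theorems.PoloidalWindowDoorPoloidalWindowRigidityClassRate

variable {C : ℝ} {v : ℝ → EuclideanSpace ℝ (Fin 3) → EuclideanSpace ℝ (Fin 3)}

/-! ### (1) the Beltrami identity: transport = stretching -/

/-- **On a Beltrami field the vorticity transport and stretching terms coincide.**  For `V ∈ C²(ℝ³,ℝ³)` divergence-free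
with `V × curl V ≡ 0`: `(V·∇)(curl V) = (curl V·∇)V` pointwise (`curl (V × ω) = (ω·∇)V − (div V)ω + (div ω)V − (V·∇)ω`,
tree `curl_cross_apply`, with `div V = 0`, `div curl V = 0`). -/
theorem convect_curl_eq_of_beltrami {V : EuclideanSpace ℝ (Fin 3) → EuclideanSpace ℝ (Fin 3)} (hV : ContDiff ℝ 2 V)
    (hdiv : VectorCalculus.IsDivFree V) (hbel : ∀ y, cross (V y) (curl V y) = 0) (x : EuclideanSpace ℝ (Fin 3)) :
    convect V (curl V) x = convect (curl V) V x := by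
  have hVd : DifferentiableAt ℝ V x := (hV.differentiable (by norm_num)).differentiableAt
  have hωC : ContDiff ℝ 1 (curl V) := contDiff_curl (n := 1) (by exact_mod_cast hV)
  have hωd : DifferentiableAt ℝ (curl V) x := (hωC.differentiable one_ne_zero).differentiableAt
  have h := curl_cross_apply (W := V) (Ω := curl V) hVd hωd
  have h0 : (fun y => cross (V y) (curl V y)) = 0 := funext fun y => hbel y
  rw [h0, curl_zero, hdiv x, divergence_curl_eq_zero_holds V hV x, zero_smul, zero_smul, sub_zero, add_zero] at h
  rw [convect_apply, convect_apply]
  exact (sub_eq_zero.1 h.symm).symm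

/-! ### (2) the vorticity of a Beltrami profile is caloric -/

/-- **The vorticity of a Beltrami profile of the class solves the heat equation** `∂ₜ curl v = Δ curl v` pointwise on
the open slab (two-sided time derivative): the profile is a classical Navier–Stokes solution on every window `(t₀, 0)`,
and in its vorticity equation the transport and stretching terms cancel by `convect_curl_eq_of_beltrami`. -/
theorem timeDeriv_curl_eq_laplacian_of_beltrami (hrate : HasTypeITimeDecay C v)
    (hcont : ContinuousOn (uncurry v) (Iio (0 : ℝ) ×ˢ univ))
    (hmild : ∀ s t : ℝ, s < t → t < 0 → ∀ x,
      v t x = UnboundedOperators.heatExtension (v s) (t - s) x - oseenDuhamel 1 s v v t x)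
    (hdiv : ∀ t < 0, VectorCalculus.IsDivFree (v t))
    (hbel : ∀ s < 0, ∀ y, cross (v s y) (curl (v s) y) = 0) {t : ℝ} (ht : t < 0) (x : EuclideanSpace ℝ (Fin 3)) :
    FluidPDE.timeDeriv (vorticity v) t x = (Δ (curl (v t))) x := by
  have hA : IsTypeIAncientMild C v := isTypeIAncientMild_of_class hrate hcont hmild hdiv
  -- a window `(t₀, 0) ∋ t`
  have ht₀ : t - 1 < 0 := by linarith
  have htI : t ∈ Ioo (t - 1) 0 := ⟨by linarith, ht⟩
  obtain ⟨p, hcl⟩ := hA.exists_isClassicalNSSolutionOn_Ioo ht₀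
  have hveq := hcl.vorticity_eq isOpen_Ioo.uniqueDiffOn (by rw [isOpen_Ioo.interior_eq]; exact subset_closure)
    (fun _ _ y => curl_zero y) htI x
  have hC2 : ContDiff ℝ 2 (v t) := (analyticOnNhd_slice hcont (bdd_of_hasTypeITimeDecay hrate) hmild ht).contDiff
  have hcomm := convect_curl_eq_of_beltrami hC2 (hdiv t ht) (hbel t ht) x
  rw [vorticity_apply, hcomm, one_smul] at hveq
  have hwt : timeDerivWithin (Ioo (t - 1) 0) (vorticity v) t x = (Δ (curl (v t))) x :=
    add_right_cancel (hveq.trans (add_comm _ _))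
  rw [← hwt, timeDerivWithin_apply, FluidPDE.timeDeriv_apply, derivWithin_of_isOpen isOpen_Ioo htI]

/-! ### (3) the caloric Liouville step and (4) the irrotational stratum -/

/-- **Beltrami profiles of the class are irrotational.**  The vorticity is a bounded ancient caloric field on every slab
`(−∞, s₀) × ℝ³`, `s₀ < 0` (bound `C₂/(−s₀)` from the class's vorticity rate), hence constant there
(`Literature.Analysis.PDE.heat_liouville`), and the constant is `O(1/(−t))` as `t → −∞`, hence zero. -/
theorem curl_eq_zero_of_beltrami (hrate : HasTypeITimeDecay C v)
    (hcont : ContinuousOn (uncurry v) (Iio (0 : ℝ) ×ˢ univ))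
    (hmild : ∀ s t : ℝ, s < t → t < 0 → ∀ x,
      v t x = UnboundedOperators.heatExtension (v s) (t - s) x - oseenDuhamel 1 s v v t x)
    (hdiv : ∀ t < 0, VectorCalculus.IsDivFree (v t))
    (hbel : ∀ s < 0, ∀ y, cross (v s y) (curl (v s) y) = 0) :
    ∀ t < 0, ∀ x, curl (v t) x = 0 := by
  have hA : IsTypeIAncientMild C v := isTypeIAncientMild_of_class hrate hcont hmild hdiv
  obtain ⟨C₂, hC₂⟩ := exists_curl_rate_of_class hrate hcont hmild
  -- joint smoothness of the vorticity on the open slab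
  have hsm : IsSmoothSpaceTimeOn (Iio 0) v := hA.contDiffOn
  have hsmω : IsSmoothSpaceTimeOn (Iio 0) (vorticity v) := hsm.isSmoothSpaceTimeOn_vorticity isOpen_Iio.uniqueDiffOn
  have hO : IsOpen (Iio (0 : ℝ) ×ˢ (univ : Set (EuclideanSpace ℝ (Fin 3)))) := isOpen_Iio.prod isOpen_univ
  have hω2 : ContDiffOn ℝ 2 (uncurry (vorticity v)) (Iio (0 : ℝ) ×ˢ univ) :=
    hsmω.of_le (by norm_cast)
  -- the heat equation in the Carleman frame, on the whole open slab
  have hheat : ∀ z ∈ Iio (0 : ℝ) ×ˢ (univ : Set (EuclideanSpace ℝ (Fin 3))),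
      Carleman.dt (uncurry (vorticity v)) z = Carleman.lap (uncurry (vorticity v)) z := by
    rintro ⟨t, x⟩ hz
    have ht : t < 0 := (mem_prod.1 hz).1
    have hd : DifferentiableAt ℝ (uncurry (vorticity v)) (t, x) :=
      (hω2.differentiableOn (by norm_num)).differentiableAt (hO.mem_nhds hz)
    rw [Carleman.dt_uncurry hd, Carleman.lap_uncurry hO hz hω2,
      timeDeriv_curl_eq_laplacian_of_beltrami hrate hcont hmild hdiv hbel ht x, vorticity_apply]
  -- constancy below every `s₀ < 0`
  have hconst : ∀ s₀ < 0, ∀ t t' : ℝ, t < s₀ → t' < s₀ → ∀ x x' : EuclideanSpace ℝ (Fin 3),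
      curl (v t) x = curl (v t') x' := by
    intro s₀ hs₀ t t' ht ht' x x'
    have hsub : Iio s₀ ×ˢ (univ : Set (EuclideanSpace ℝ (Fin 3))) ⊆ Iio 0 ×ˢ univ :=
      prod_mono (Iio_subset_Iio hs₀.le) Subset.rfl
    have hC₂0 : 0 ≤ C₂ := by
      have h := hC₂ t (ht.trans hs₀) x
      have hpos : 0 < -t := by linarith
      exact (div_nonneg_iff.1 ((norm_nonneg _).trans h)).elim (fun h' => h'.1)
        (fun h' => absurd h'.2 (not_le.2 hpos))
    have key := Literature.Analysis.PDE.heat_liouville (u := uncurry (vorticity v)) (T := s₀) (A := C₂ / (-s₀))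
      (γ := 0) le_rfl zero_lt_one (hω2.mono hsub) (fun z hz => hheat z (hsub hz)) ?_
      (z := (t, x)) (w := (t', x')) (mem_prod.2 ⟨ht, mem_univ _⟩) (mem_prod.2 ⟨ht', mem_univ _⟩)
    · simpa [vorticity_apply] using key
    · rintro ⟨τ, y⟩ hz
      have hτ : τ < s₀ := (mem_prod.1 hz).1
      have hτ0 : τ < 0 := hτ.trans hs₀
      rw [Real.rpow_zero, mul_one]
      show ‖vorticity v τ y‖ ≤ C₂ / (-s₀)
      rw [vorticity_apply]
      calc ‖curl (v τ) y‖ ≤ C₂ / (-τ) := hC₂ τ hτ0 y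
        _ ≤ C₂ / (-s₀) := div_le_div_of_nonneg_left hC₂0 (by linarith) (by linarith)
  -- the constant is `O(1/(−t))`, hence zero
  intro t ht x
  by_contra hne
  set ε : ℝ := ‖curl (v t) x‖ with hε
  have hε0 : 0 < ε := norm_pos_iff.2 hne
  set t' : ℝ := t - 1 - C₂ / ε with ht'def
  have hC₂0 : 0 ≤ C₂ := by
    have h := hC₂ t ht x
    have hpos : 0 < -t := by linarith
    exact (div_nonneg_iff.1 ((norm_nonneg _).trans h)).elim (fun h' => h'.1)
      (fun h' => absurd h'.2 (not_le.2 hpos))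
  have hq : 0 ≤ C₂ / ε := div_nonneg hC₂0 hε0.le
  have ht's : t' < t / 2 := by rw [ht'def]; linarith
  have hts : t < t / 2 := by linarith
  have hs₀ : t / 2 < 0 := by linarith
  have ht'0 : 0 < -t' := by rw [ht'def]; linarith
  have heq : curl (v t) x = curl (v t') x := hconst (t / 2) hs₀ t t' hts ht's x x
  have hb : ε ≤ C₂ / (-t') := by rw [hε, heq]; exact hC₂ t' (by linarith) x
  have hlt : C₂ / (-t') < ε := by
    rw [div_lt_iff₀ ht'0, ht'def]
    have : ε * (-(t - 1 - C₂ / ε)) = ε * (1 - t) + C₂ := by field_simp; ring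
    rw [this]
    nlinarith
  linarith

/-- **BELTRAMI TYPE-I PROFILES ARE TRIVIAL**: a profile of the class whose Lamb vector vanishes on every slice is
identically zero (irrotational by `curl_eq_zero_of_beltrami`, then tree `eq_zero_of_irrotational`). -/
theorem eq_zero_of_beltrami (hrate : HasTypeITimeDecay C v)
    (hcont : ContinuousOn (uncurry v) (Iio (0 : ℝ) ×ˢ univ))
    (hmild : ∀ s t : ℝ, s < t → t < 0 → ∀ x,
      v t x = UnboundedOperators.heatExtension (v s) (t - s) x - oseenDuhamel 1 s v v t x)
    (hdiv : ∀ t < 0, VectorCalculus.IsDivFree (v t))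
    (hbel : ∀ s < 0, ∀ y, cross (v s y) (curl (v s) y) = 0) : ∀ t < 0, ∀ x, v t x = 0 :=
  eq_zero_of_irrotational hrate hcont hmild hdiv (curl_eq_zero_of_beltrami hrate hcont hmild hdiv hbel)

/-- **The Beltrami stratum of the family's profile class is settled**: such a profile is not backward-singular. -/
theorem not_backwardSingular_of_beltrami (hrate : HasTypeITimeDecay C v)
    (hcont : ContinuousOn (uncurry v) (Iio (0 : ℝ) ×ˢ univ))
    (hmild : ∀ s t : ℝ, s < t → t < 0 → ∀ x,
      v t x = UnboundedOperators.heatExtension (v s) (t - s) x - oseenDuhamel 1 s v v t x)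
    (hdiv : ∀ t < 0, VectorCalculus.IsDivFree (v t))
    (hbel : ∀ s < 0, ∀ y, cross (v s y) (curl (v s) y) = 0) : ¬ IsBackwardSingularPoint v 0 :=
  nonflatLiouville_of_irrotational hrate hcont hmild hdiv (curl_eq_zero_of_beltrami hrate hcont hmild hdiv hbel)

/-! ### window → slab for the Lamb vector -/

/-- **Slice Lamb vectors of a profile of the class are real-analytic**: for `s < 0`, `y ↦ v s y × curl (v s) y` is
real-analytic on `ℝ³` (slice analyticity, tree `…Ancient.analyticOnNhd_slice`, and the continuous bilinear `crossCLM`). -/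
theorem analyticOnNhd_lamb_slice (hrate : HasTypeITimeDecay C v)
    (hcont : ContinuousOn (uncurry v) (Iio (0 : ℝ) ×ˢ univ))
    (hmild : ∀ s t : ℝ, s < t → t < 0 → ∀ x,
      v t x = UnboundedOperators.heatExtension (v s) (t - s) x - oseenDuhamel 1 s v v t x)
    {s : ℝ} (hs : s < 0) :
    AnalyticOnNhd ℝ (fun y => cross (v s y) (curl (v s) y)) univ := by
  have hslice := analyticOnNhd_slice hcont (bdd_of_hasTypeITimeDecay hrate) hmild hs
  have hcurl := analyticOnNhd_curl hslice
  intro y hy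
  have h := (crossCLM.analyticAt_bilinear (v s y, curl (v s) y)).comp₂ (hslice y hy) (hcurl y hy)
  simpa only [crossCLM_apply] using h

/-- **Window → slab for the Lamb vector**: for a profile of the class, if at every `s < 0` the Lamb vector vanishes on
some nonempty open window, it vanishes on every slice (identity theorem on the connected `ℝ³`). -/
theorem lambWindowToSlab (hrate : HasTypeITimeDecay C v)
    (hcont : ContinuousOn (uncurry v) (Iio (0 : ℝ) ×ˢ univ))
    (hmild : ∀ s t : ℝ, s < t → t < 0 → ∀ x,
      v t x = UnboundedOperators.heatExtension (v s) (t - s) x - oseenDuhamel 1 s v v t x)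
    (hwin : ∀ s < 0, ∃ U : Set (EuclideanSpace ℝ (Fin 3)), IsOpen U ∧ U.Nonempty ∧
      ∀ y ∈ U, cross (v s y) (curl (v s) y) = 0) :
    ∀ s < 0, ∀ y, cross (v s y) (curl (v s) y) = 0 := by
  intro s hs y
  obtain ⟨U, hU, ⟨y₀, hy₀⟩, hal⟩ := hwin s hs
  have hev : (fun y => cross (v s y) (curl (v s) y)) =ᶠ[𝓝 y₀] 0 :=
    Filter.eventually_of_mem (hU.mem_nhds hy₀) fun y hy => hal y hy
  exact (analyticOnNhd_lamb_slice hrate hcont hmild hs).eqOn_zero_of_preconnected_of_eventuallyEq_zero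
    isPreconnected_univ (mem_univ y₀) hev (mem_univ y)

/-! ### the door's profile window crux in the generic template's `F`-form -/

/-- **THE PROFILE WINDOW CRUX OF THE LAMB-VECTOR DOOR, PROVED** (the `hcrux` hypothesis of
`…LocalSineTubeDoorGenericDoor.genericDoor_of_profileWindowRigidity` for `F(x, A) = ‖x × curlCLM A‖`): a profile of the
family's Type-I class whose Lamb vector `v(s,·) × curl v(s,·)` vanishes on a nonempty open window of every slice `s < 0`
is not backward-singular at the apex. -/
theorem beltramiWindowRigidity :
    ∀ (C : ℝ) (v : ℝ → EuclideanSpace ℝ (Fin 3) → EuclideanSpace ℝ (Fin 3)),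
      Literature.Analysis.FluidPDE.HasTypeITimeDecay C v →
      ContinuousOn (Function.uncurry v) (Set.Iio (0 : ℝ) ×ˢ Set.univ) →
      (∀ s t : ℝ, s < t → t < 0 → ∀ x, v t x =
        Literature.Analysis.UnboundedOperators.heatExtension (v s) (t - s) x -
          Literature.Analysis.FluidPDE.oseenDuhamel 1 s v v t x) →
      (∀ t < 0, Literature.Analysis.FluidPDE.VectorCalculus.IsDivFree (v t)) →
      (∀ s < 0, ∃ U : Set (EuclideanSpace ℝ (Fin 3)), IsOpen U ∧ U.Nonempty ∧
        ∀ z ∈ U, (fun (x : EuclideanSpace ℝ (Fin 3)) (A : EuclideanSpace ℝ (Fin 3) →L[ℝ] EuclideanSpace ℝ (Fin 3)) =>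
          ‖Literature.Analysis.FluidPDE.cross x (Literature.Analysis.FluidPDE.curlCLM A)‖) (v s z) (fderiv ℝ (v s) z) = 0) →
      ¬ Literature.Analysis.FluidPDE.IsBackwardSingularPoint v 0 := by
  intro C v hrate hcont hmild hdiv hwin
  refine not_backwardSingular_of_beltrami hrate hcont hmild hdiv (lambWindowToSlab hrate hcont hmild fun s hs => ?_)
  obtain ⟨U, hU, hne, hal⟩ := hwin s hs
  refine ⟨U, hU, hne, fun y hy => ?_⟩
  have h := hal y hy
  simp only [norm_eq_zero] at h
  rwa [← curl_eq_curlCLM] at h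

end Summit.NavierStokesRegularity.NavierStokesRegularity.Theorems.LocalLambTubeDoorBeltramiProfileRigidity

end
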